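import Literature.AlgebraicTopology.FundamentalGroup.InclHomTransport
import Literature.AlgebraicTopology.Homotopy.StrongDeformationRetractUnion
import HarnessLib

/-!
# Seifert–van Kampen for a closed cover with collars (e.g. a Heegaard splitting)

Topic `Literature/AlgebraicTopology/FundamentalGroup`.  We prove the form of van Kampen's
theorem used for spaces glued from two closed pieces along a common part of their boundaries —
a closed `3`-manifold from the two handlebodies of a Heegaard splitting, `∂X_l = H_i ∪_F H_j` for
a trisection (Abrams–Gay–Kirby 2018, p. 1540) —, in the epimorphic situation:

**Theorem** (`VanKampen.surjective_and_ker_eq_of_closed_cover_collars`).  *Let `R₁, R₂ ⊆ X` be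
closed subsets of a topological space with `R₁ ∩ R₂ = F`, `x₀ ∈ F`, and suppose that `F` has
"collars" on both sides: sets `F ⊆ C_a ⊆ R_a`, open in `R_a`, which strong deformation retract
onto `F` (`a = 1, 2`); that `R₁`, `R₂`, `F` are path connected; and that the maps
`π₁(F, x₀) → π₁(R_a, x₀)` induced by the inclusions are surjective.  Then `π₁(F, x₀) → π₁(R₁ ∪ R₂, x₀)`
is surjective and its kernel is the normal closure of `ker (π₁ F → π₁ R₁) ∪ ker (π₁ F → π₁ R₂)`;
that is, `π₁(R₁ ∪ R₂) ≅ π₁(F) ⧸ ⟪K₁ ∪ K₂⟫`.*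

This is Hatcher's Thm. 1.20 (with Lemma 1.15) applied, as in all of §1.2, to the open
neighbourhoods `U = R₁ ∪ C₂`, `T = R₂ ∪ C₁` of the closed pieces, which deformation retract onto
them (Prop. 1.17), with `U ∩ T = C₁ ∪ C₂` deformation retracting onto `F`: the tree's
`VanKampen.surjective_inclHom_and_ker_eq_of_deformationRetracts` (`VanKampenDeformation.lean`) in
the subspace `↥(R₁ ∪ R₂)`, the collars being absorbed by
`IsStrongDeformationRetractOf.union_of_isClosed` (`StrongDeformationRetractUnion.lean`), and the
result transported back to subsets of `X` (`InclHomTransport.lean`; the two-sided form of the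
subspace bookkeeping is `VanKampen.exists_mulEquiv_preimageVal_forall_comm` below).  Everything is
proved; no definitions.

## References

* A. Hatcher, *Algebraic Topology*, Cambridge Univ. Press (2002), §1.2: Lemma 1.15, Thm. 1.20,
  and the remark on closed sets with deformation-retracting neighbourhoods preceding
  Example 1.21; Prop. 1.17. [HatcherAT2002]
* A. Abrams, D. Gay, R. Kirby, *Group trisections and smooth 4-manifolds*, Geom. Topol. 22
  (2018), p. 1540 (`π₁` of `H_i ∪_F H_j`). [AbramsGayKirby2018]
-/

noncomputable section

open Set Function Topology

namespace Literature.AlgebraicTopology.FundamentalGroup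

namespace VanKampen

variable {Y : Type*} [TopologicalSpace Y]

/-! ### Subspace of a subspace, uniformly in the intermediate set -/

/-- **The maps induced by `A ⊆ B ⊆ W`, computed in `Y` and in the subspace `↥W`, agree along the
canonical isomorphisms — uniformly in `B`.**  For `A ⊆ W` and `x₀ ∈ A` there is an isomorphism
`θ_A : π₁(↥A, x₀) ≅ π₁(↥(W ↓∩ A), x₀)` with `inclHom (W ↓∩ A) ∘ θ_A = inclHomOfSubset (A ⊆ W)`,
and for every intermediate `A ⊆ B ⊆ W` an isomorphism `θ_B : π₁(↥B, x₀) ≅ π₁(↥(W ↓∩ B), x₀)` with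
`inclHom (W ↓∩ B) ∘ θ_B = inclHomOfSubset (B ⊆ W)` and
`inclHomOfSubset (W ↓∩ A ⊆ W ↓∩ B) ∘ θ_A = θ_B ∘ inclHomOfSubset (A ⊆ B)` (the same `θ_A` for
all `B`). [cite: HatcherAT2002, §1.1 (p. 34) and Prop. 1.18] -/
theorem exists_mulEquiv_preimageVal_forall_comm {A W : Set Y} (hAW : A ⊆ W) {x₀ : Y}
    (hx : x₀ ∈ A) :
    ∃ θA : _root_.FundamentalGroup A ⟨x₀, hx⟩ ≃*
        _root_.FundamentalGroup ↥(Subtype.val ⁻¹' A : Set W) ⟨⟨x₀, hAW hx⟩, hx⟩,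
      (∀ a, inclHom (Subtype.val ⁻¹' A : Set W) ⟨x₀, hAW hx⟩ hx (θA a) =
        inclHomOfSubset hAW x₀ hx (hAW hx) a) ∧
      ∀ {B : Set Y} (hAB : A ⊆ B) (hBW : B ⊆ W),
        ∃ θB : _root_.FundamentalGroup B ⟨x₀, hAB hx⟩ ≃*
            _root_.FundamentalGroup ↥(Subtype.val ⁻¹' B : Set W) ⟨⟨x₀, hAW hx⟩, hAB hx⟩,
          (∀ b, inclHom (Subtype.val ⁻¹' B : Set W) ⟨x₀, hAW hx⟩ (hAB hx) (θB b) =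
            inclHomOfSubset hBW x₀ (hAB hx) (hAW hx) b) ∧
          (∀ a, inclHomOfSubset
              (fun _ hw => hAB hw : (Subtype.val ⁻¹' A : Set W) ⊆ Subtype.val ⁻¹' B)
              ⟨x₀, hAW hx⟩ hx (hAB hx) (θA a) =
            θB (inclHomOfSubset hAB x₀ hx (hAB hx) a)) := by
  -- the canonical homeomorphism for `A`
  let ηA : A ≃ₜ ↥(Subtype.val ⁻¹' A : Set W) :=
    { toFun := fun a => ⟨⟨a, hAW a.2⟩, a.2⟩
      invFun := fun w => ⟨w.1, w.2⟩
      left_inv := fun _ => rfl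
      right_inv := fun _ => rfl
      continuous_toFun := (continuous_subtype_val.subtype_mk _).subtype_mk _
      continuous_invFun := (continuous_subtype_val.comp continuous_subtype_val).subtype_mk _ }
  have hηA : ηA ⟨x₀, hx⟩ = ⟨⟨x₀, hAW hx⟩, hx⟩ := rfl
  refine ⟨fundamentalGroupEquivOfHomeomorph ηA hηA, fun a => ?_, fun {B} hAB hBW => ?_⟩
  · rw [fundamentalGroupEquivOfHomeomorph_apply]
    induction a using PushoutData.ind_fromPath with
    | h γ =>
      have e₁ : _root_.FundamentalGroup.mapOfEq (ηA : C(A, ↥(Subtype.val ⁻¹' A : Set W))) hηA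
            (_root_.FundamentalGroup.fromPath (Path.Homotopic.Quotient.mk γ)) =
          _root_.FundamentalGroup.fromPath (Path.Homotopic.Quotient.mk
            ((γ.map ηA.continuous).cast rfl rfl)) := by
        rw [_root_.FundamentalGroup.mapOfEq_apply]
        rfl
      have e₂ : inclHomOfSubset hAW x₀ hx (hAW hx)
            (_root_.FundamentalGroup.fromPath (Path.Homotopic.Quotient.mk γ)) =
          _root_.FundamentalGroup.fromPath (Path.Homotopic.Quotient.mk
            ((γ.map (continuous_inclusion hAW)).cast rfl rfl)) := by
        rw [inclHomOfSubset, _root_.FundamentalGroup.mapOfEq_apply]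
        rfl
      rw [e₁, e₂]
      refine (inclHom_fromPath _ _).trans ?_
      exact congrArg (fun p => _root_.FundamentalGroup.fromPath (Path.Homotopic.Quotient.mk p))
        (by ext t; rfl)
  · -- the canonical homeomorphism for `B`
    let ηB : B ≃ₜ ↥(Subtype.val ⁻¹' B : Set W) :=
      { toFun := fun b => ⟨⟨b, hBW b.2⟩, b.2⟩
        invFun := fun w => ⟨w.1, w.2⟩
        left_inv := fun _ => rfl
        right_inv := fun _ => rfl
        continuous_toFun := (continuous_subtype_val.subtype_mk _).subtype_mk _
        continuous_invFun := (continuous_subtype_val.comp continuous_subtype_val).subtype_mk _ }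
    have hηB : ηB ⟨x₀, hAB hx⟩ = ⟨⟨x₀, hAW hx⟩, hAB hx⟩ := rfl
    refine ⟨fundamentalGroupEquivOfHomeomorph ηB hηB, fun b => ?_, fun a => ?_⟩
    · rw [fundamentalGroupEquivOfHomeomorph_apply]
      induction b using PushoutData.ind_fromPath with
      | h γ =>
        have e₁ : _root_.FundamentalGroup.mapOfEq (ηB : C(B, ↥(Subtype.val ⁻¹' B : Set W))) hηB
              (_root_.FundamentalGroup.fromPath (Path.Homotopic.Quotient.mk γ)) =
            _root_.FundamentalGroup.fromPath (Path.Homotopic.Quotient.mk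
              ((γ.map ηB.continuous).cast rfl rfl)) := by
          rw [_root_.FundamentalGroup.mapOfEq_apply]
          rfl
        have e₂ : inclHomOfSubset hBW x₀ (hAB hx) (hAW hx)
              (_root_.FundamentalGroup.fromPath (Path.Homotopic.Quotient.mk γ)) =
            _root_.FundamentalGroup.fromPath (Path.Homotopic.Quotient.mk
              ((γ.map (continuous_inclusion hBW)).cast rfl rfl)) := by
          rw [inclHomOfSubset, _root_.FundamentalGroup.mapOfEq_apply]
          rfl
        rw [e₁, e₂]
        refine (inclHom_fromPath _ _).trans ?_
        exact congrArg (fun p => _root_.FundamentalGroup.fromPath (Path.Homotopic.Quotient.mk p))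
          (by ext t; rfl)
    · rw [fundamentalGroupEquivOfHomeomorph_apply, fundamentalGroupEquivOfHomeomorph_apply]
      induction a using PushoutData.ind_fromPath with
      | h γ =>
        rw [inclHomOfSubset, inclHomOfSubset, _root_.FundamentalGroup.mapOfEq_apply,
          _root_.FundamentalGroup.mapOfEq_apply, _root_.FundamentalGroup.mapOfEq_apply,
          _root_.FundamentalGroup.mapOfEq_apply]
        rfl

/-! ### The theorem -/

section ClosedCover

variable {X : Type*} [TopologicalSpace X]

/-- **Seifert–van Kampen for two closed pieces meeting along a two-sidedly collared subset,
epimorphic form.**  Let `R₁, R₂ ⊆ X` be closed with `R₁ ∩ R₂ = F ∋ x₀`; let `F ⊆ C_a ⊆ R_a`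
(`a = 1, 2`) be open in `R_a` (`C_a = R_a ∩ O_a` with `O_a` open) and strong deformation retract
onto `F`; let `R₁`, `R₂`, `F` be path connected and the maps `π₁(F, x₀) → π₁(R_a, x₀)` induced
by the inclusions surjective.  Then `π₁(F, x₀) → π₁(R₁ ∪ R₂, x₀)` (induced by the inclusion) is
surjective and its kernel is the normal closure of `ker (π₁ F → π₁ R₁) ∪ ker (π₁ F → π₁ R₂)`
(Hatcher, Thm. 1.20 for the open neighbourhoods `R₁ ∪ C₂`, `R₂ ∪ C₁`, which deformation retract
onto `R₁`, `R₂`, with intersection `C₁ ∪ C₂` deformation retracting onto `F`).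
[cite: HatcherAT2002, Thm. 1.20 with Lemma 1.15 and Prop. 1.17] -/
theorem surjective_and_ker_eq_of_closed_cover_collars {R₁ R₂ F C₁ C₂ O₁ O₂ : Set X}
    (hR₁ : IsClosed R₁) (hR₂ : IsClosed R₂) (hFR₁ : F ⊆ R₁) (hFR₂ : F ⊆ R₂) (hF : R₁ ∩ R₂ ⊆ F)
    (hO₁ : IsOpen O₁) (hC₁ : C₁ = R₁ ∩ O₁) (hFC₁ : F ⊆ C₁)
    (hO₂ : IsOpen O₂) (hC₂ : C₂ = R₂ ∩ O₂) (hFC₂ : F ⊆ C₂)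
    (hsdr₁ : Homotopy.IsStrongDeformationRetractOf F C₁)
    (hsdr₂ : Homotopy.IsStrongDeformationRetractOf F C₂)
    (hR₁pc : IsPathConnected R₁) (hR₂pc : IsPathConnected R₂) (hFpc : IsPathConnected F)
    {x₀ : X} (hx₀ : x₀ ∈ F)
    (hs₁ : Function.Surjective (inclHomOfSubset hFR₁ x₀ hx₀ (hFR₁ hx₀)))
    (hs₂ : Function.Surjective (inclHomOfSubset hFR₂ x₀ hx₀ (hFR₂ hx₀))) :
    Function.Surjective
        (inclHomOfSubset (hFR₁.trans subset_union_left : F ⊆ R₁ ∪ R₂) x₀ hx₀ (Or.inl (hFR₁ hx₀))) ∧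
      (inclHomOfSubset (hFR₁.trans subset_union_left : F ⊆ R₁ ∪ R₂) x₀ hx₀ (Or.inl (hFR₁ hx₀))).ker =
        Subgroup.normalClosure
          (((inclHomOfSubset hFR₁ x₀ hx₀ (hFR₁ hx₀)).ker : Set _) ∪
            (inclHomOfSubset hFR₂ x₀ hx₀ (hFR₂ hx₀)).ker) := by
  -- notation in the subspace `Y = ↥(R₁ ∪ R₂)`
  have hC₁R₁ : C₁ ⊆ R₁ := fun x hx => (hC₁ ▸ hx : x ∈ R₁ ∩ O₁).1
  have hC₂R₂ : C₂ ⊆ R₂ := fun x hx => (hC₂ ▸ hx : x ∈ R₂ ∩ O₂).1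
  have hW : F ⊆ R₁ ∪ R₂ := hFR₁.trans subset_union_left
  set P : Set ↥(R₁ ∪ R₂) := Subtype.val ⁻¹' R₁ with hP
  set Q : Set ↥(R₁ ∪ R₂) := Subtype.val ⁻¹' R₂ with hQ
  set F' : Set ↥(R₁ ∪ R₂) := Subtype.val ⁻¹' F with hF'
  set C₁' : Set ↥(R₁ ∪ R₂) := Subtype.val ⁻¹' C₁ with hC₁'
  set C₂' : Set ↥(R₁ ∪ R₂) := Subtype.val ⁻¹' C₂ with hC₂'
  have hPcl : IsClosed P := hR₁.preimage continuous_subtype_val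
  have hQcl : IsClosed Q := hR₂.preimage continuous_subtype_val
  have hPQ : P ∩ Q ⊆ F' := fun y hy => hF hy
  have hF'P : F' ⊆ P := fun y hy => hFR₁ hy
  have hF'Q : F' ⊆ Q := fun y hy => hFR₂ hy
  have hF'C₁ : F' ⊆ C₁' := fun y hy => hFC₁ hy
  have hF'C₂ : F' ⊆ C₂' := fun y hy => hFC₂ hy
  have hC₁P : C₁' ⊆ P := fun y hy => hC₁R₁ hy
  have hC₂Q : C₂' ⊆ Q := fun y hy => hC₂R₂ hy
  have hcovPQ : P ∪ Q = univ := eq_univ_of_forall fun y => y.2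
  -- the open neighbourhoods `U = P ∪ C₂'`, `T = Q ∪ C₁'`
  set U : Set ↥(R₁ ∪ R₂) := P ∪ C₂' with hU
  set T : Set ↥(R₁ ∪ R₂) := Q ∪ C₁' with hT
  have hUo : IsOpen U := by
    have : U = (Subtype.val ⁻¹' (R₂ \ O₂))ᶜ := by
      ext y
      simp only [hU, hP, hC₂', mem_union, mem_preimage, mem_compl_iff, mem_sdiff, not_and,
        not_not, hC₂, mem_inter_iff]
      constructor
      · rintro (hy | ⟨-, hy⟩) hy₂
        · exact (hC₂ ▸ hFC₂ (hF ⟨hy, hy₂⟩) : (y : X) ∈ R₂ ∩ O₂).2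
        · exact hy
      · intro h
        rcases y.2 with hy | hy
        · exact Or.inl hy
        · exact Or.inr ⟨hy, h hy⟩
    rw [this]
    exact ((hR₂.sdiff hO₂).preimage continuous_subtype_val).isOpen_compl
  have hTo : IsOpen T := by
    have : T = (Subtype.val ⁻¹' (R₁ \ O₁))ᶜ := by
      ext y
      simp only [hT, hQ, hC₁', mem_union, mem_preimage, mem_compl_iff, mem_sdiff, not_and,
        not_not, hC₁, mem_inter_iff]
      constructor
      · rintro (hy | ⟨-, hy⟩) hy₁
        · exact (hC₁ ▸ hFC₁ (hF ⟨hy₁, hy⟩) : (y : X) ∈ R₁ ∩ O₁).2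
        · exact hy
      · intro h
        rcases y.2 with hy | hy
        · exact Or.inr ⟨hy, h hy⟩
        · exact Or.inl hy
    rw [this]
    exact ((hR₁.sdiff hO₁).preimage continuous_subtype_val).isOpen_compl
  have hcov : U ∪ T = univ := by
    rw [← univ_subset_iff, ← hcovPQ]
    exact union_subset (subset_union_left.trans subset_union_left)
      (subset_union_left.trans subset_union_right)
  have hPU : P ⊆ U := subset_union_left
  have hQT : Q ⊆ T := subset_union_left
  -- the deformation retractions
  have hsdr₁' : Homotopy.IsStrongDeformationRetractOf F' C₁' :=
    hsdr₁.preimage_val (hC₁R₁.trans subset_union_left)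
  have hsdr₂' : Homotopy.IsStrongDeformationRetractOf F' C₂' :=
    hsdr₂.preimage_val (hC₂R₂.trans subset_union_right)
  have hPsdr : Homotopy.IsStrongDeformationRetractOf P U :=
    hsdr₂'.union_of_isClosed hPcl hQcl hPQ hF'P hF'C₂ hC₂Q
  have hQsdr : Homotopy.IsStrongDeformationRetractOf Q T :=
    hsdr₁'.union_of_isClosed hQcl hPcl (fun y hy => hPQ ⟨hy.2, hy.1⟩) hF'Q hF'C₁ hC₁P
  have hUT : U ∩ T = C₁' ∪ C₂' := by
    apply Subset.antisymm
    · rintro y ⟨hyU | hyU, hyT | hyT⟩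
      · exact Or.inl (hF'C₁ (hPQ ⟨hyU, hyT⟩))
      · exact Or.inl hyT
      · exact Or.inr hyU
      · exact Or.inr hyU
    · rintro y (hy | hy)
      · exact ⟨hPU (hC₁P hy), Or.inr hy⟩
      · exact ⟨Or.inr hy, hQT (hC₂Q hy)⟩
  have hFsdr : Homotopy.IsStrongDeformationRetractOf F' (U ∩ T) := by
    rw [hUT]
    -- `C₁'` is a strong deformation retract of `C₁' ∪ C₂'` (absorb `C₂'`), then `F'` of `C₁'`
    have h1 : Homotopy.IsStrongDeformationRetractOf C₁' (C₁' ∪ C₂') := by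
      refine hsdr₂'.union_of_inter_subset (fun y hy => hPQ ⟨hC₁P hy.1, hC₂Q hy.2⟩)
        (fun y hy => hF'C₁ hy.1) (fun y hy => ?_) (fun y hy => ?_)
      · exact hF'C₁ (hPQ ⟨hPcl.closure_subset_iff.2 hC₁P hy.1, hC₂Q hy.2⟩)
      · exact hF'C₂ (hPQ ⟨hC₁P hy.2, hQcl.closure_subset_iff.2 hC₂Q hy.1⟩)
    exact h1.trans hsdr₁' subset_union_left hF'C₁
  -- path connectivity
  have hPpc : IsPathConnected P := hR₁pc.preimage_coe subset_union_left
  have hQpc : IsPathConnected Q := hR₂pc.preimage_coe subset_union_right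
  have hF'pc : IsPathConnected F' := hFpc.preimage_coe hW
  have hUpc : IsPathConnected U := hPsdr.isPathConnected (by rwa [inter_eq_left.2 hPU])
  have hTpc : IsPathConnected T := hQsdr.isPathConnected (by rwa [inter_eq_left.2 hQT])
  have hF'UT : F' ⊆ U ∩ T := fun y hy => ⟨hPU (hF'P hy), hQT (hF'Q hy)⟩
  have hmeet : IsPathConnected (U ∩ T) :=
    hFsdr.isPathConnected (by rwa [inter_eq_left.2 hF'UT])
  -- the subspace bookkeeping
  obtain ⟨θF, hθF, hθB⟩ := exists_mulEquiv_preimageVal_forall_comm hW hx₀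
  obtain ⟨θ₁, -, hθ₁⟩ := hθB hFR₁ subset_union_left
  obtain ⟨θ₂, -, hθ₂⟩ := hθB hFR₂ subset_union_right
  have hxF' : (⟨x₀, hW hx₀⟩ : ↥(R₁ ∪ R₂)) ∈ F' := hx₀
  -- surjectivity of the edge maps in the subspace
  have hsP : Function.Surjective (inclHomOfSubset hF'P _ hxF' (hF'P hxF')) :=
    (surjective_iff_of_mulEquiv_comm _ _ θF θ₁ hθ₁).1 hs₁
  have hsQ : Function.Surjective (inclHomOfSubset hF'Q _ hxF' (hF'Q hxF')) :=
    (surjective_iff_of_mulEquiv_comm _ _ θF θ₂ hθ₂).1 hs₂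
  -- van Kampen in the subspace
  obtain ⟨hsurj, hker⟩ := surjective_inclHom_and_ker_eq_of_deformationRetracts hUo hTo hcov hUpc
    hTpc hmeet hPU hQT hF'P hF'Q hxF' hPsdr hQsdr hFsdr hsP hsQ
  -- transport back to `X`
  have hcomp : inclHomOfSubset hW x₀ hx₀ (hW hx₀) =
      (inclHom F' ⟨x₀, hW hx₀⟩ hxF').comp (θF : _ →* _) :=
    MonoidHom.ext fun a => (hθF a).symm
  refine ⟨?_, ?_⟩
  · rw [hcomp, MonoidHom.coe_comp]
    exact hsurj.comp θF.surjective
  · rw [hcomp, ← MonoidHom.comap_ker, hker, ← Subgroup.comap_normalClosure, Set.preimage_union]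
    have hk₁ : (θF ⁻¹' SetLike.coe (inclHomOfSubset hF'P _ hxF' (hF'P hxF')).ker) =
        SetLike.coe (inclHomOfSubset hFR₁ x₀ hx₀ (hFR₁ hx₀)).ker := by
      ext a
      rw [mem_preimage, SetLike.mem_coe, SetLike.mem_coe, MonoidHom.mem_ker, MonoidHom.mem_ker]
      exact (congrArg (· = 1) (hθ₁ a)).to_iff.trans (map_eq_one_iff _ θ₁.injective)
    have hk₂ : (θF ⁻¹' SetLike.coe (inclHomOfSubset hF'Q _ hxF' (hF'Q hxF')).ker) =
        SetLike.coe (inclHomOfSubset hFR₂ x₀ hx₀ (hFR₂ hx₀)).ker := by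
      ext a
      rw [mem_preimage, SetLike.mem_coe, SetLike.mem_coe, MonoidHom.mem_ker, MonoidHom.mem_ker]
      exact (congrArg (· = 1) (hθ₂ a)).to_iff.trans (map_eq_one_iff _ θ₂.injective)
    rw [hk₁, hk₂]

end ClosedCover

end VanKampen

end Literature.AlgebraicTopology.FundamentalGroup
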